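import Summits.NavierStokesRegularity.NavierStokesRegularity.Theorems.ScenarioCensusScrewBlowdownPlumbing
import HarnessLib

/-!
# LINE «screw-blowdown» port, part 3/12: §5 composition and bridges; v1.3 far-past parabolic-cylinder smallness

Re-homed for the scenario census (typer seat ns-census-typer-1 g7; lead g9 RULINGS [7] 20:33Z / [8] 21:03Z / [12](b) 21:58Z: «screw-blowdown v1.8 =
version of record; `Row_A13isqT` DECIDED IN KERNEL → CANDIDATE-DECIDED member under A13 (row already TREE); typer-1 slot 3 port of record =
`ScrewBlowdown_port_v1_8.lean` bb5f719a8be448dd (stub-free)»; critic idea-crit-3 g6 CONFORMS ×3 21:38:50Z; ref PRE-CHECKs items 13 / 15 / 20):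
VERBATIM PORT of ns-idea-4 LINE g12-1 «screw-blowdown» PORT copy `pub/ideators/ns-idea-4/lines/screw-blowdown/port/ScrewBlowdown_port_v1_8.lean`
sha16 bb5f719a8be448dd (2660 l.; lean check rc 0, 0 sorry; = the v1.7 port copy 674e939b7b0b34e8 as a literal prefix + the `LocalPersistence`
attack appendix `…LP` + the consequences `localPersistence_holds` / `farPastSpreading_holds` / `linearConeLiouville_holds` / `row_A13isqT_proved`),
split for the 400-line rule into `ScenarioCensusScrewBlowdown` (§1–§3: objects, the cell `Row_A13isqT`, obligation Props, S1 PROVED) →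
`…Plumbing` (§4, S2 PROVED) → `…Bridges` (§5 + v1.3) → `…Recurrent` (v1.4, `Row_ArecT`) → `…OffAxis` (v1.5 a) → `…Cone` (v1.5 b:
`farPast_linearCone_smallness_of_screw`) → `…Residual` (v1.5 c + v1.6: `LinearConeLiouville`, DSS rungs) → `…Propagation` (v1.7: FS, LP,
reductions; the three class-general tools are NOT re-declared — taken BY NAME, general `E`, from `Theorems/TypeIAncientMildForwardUniqueness.lean`,
ns-idea-4 extract a1b589f6dec7da83, p671177) → `…LPTools` / `…LPDuhamel` / `…LP` (the appendix: Gaussian locality, the three-term Oseen split,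
time weights; `duhamel_bound`; the bootstrap `one_step` / `persist` / `localPersistence` + the consequences incl. `row_A13isqT_proved`) →
`…Keys` (census keys).  Lean text VERBATIM in namespaces `…Theorems.ScenarioCensus.ScrewBlowdown` / `…ScrewBlowdownLP` (the line's
`…Lines.ScrewBlowdownPort` / `…PortLP` re-homed; qualified references renamed accordingly); port edits: `local notation "E3"` → `abbrev E3` (the
appendix `open`s it), `@[conjecture]` on the two Props still OPEN in this copy (`Row_ArecT`, `VanishingBlowdownLiouville`; v1.9 proves them
files-only, not of record here), four one-line docstrings added, `continuous_rotZ_angle'` not re-declared (it restates the tree's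
`Literature.Analysis.FluidPDE.continuous_rotZ_angle`, gate lint `dedup.landed`; its uses renamed), the line's `set_option linter.unusedVariables false` dropped (five proof lambdas
bind the unused `θ₀ h` as `_ _`; the unused hypothesis binder of `hasVanishingBlowdown_of_axiallyRecurrent` is spelled `_hu`, statement otherwise
identical); `set_option maxHeartbeats … in` of the appendix kept as in the line.

No census VALUE is moved by this file (row A13 is TREE already; the lead books the member A13isq-T); NS regularity is NOT proved; (L′)
`SymmetryModuliCount.TypeIAncientLiouville` is untouched (hypothesis of bridges only); no summit statement is proved by this file.
-/

-- the summit and its single problem share the name `NavierStokesRegularity` (D-0017 nested layout)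
set_option linter.dupNamespace false

namespace Summit.NavierStokesRegularity.NavierStokesRegularity.Theorems.ScenarioCensus.ScrewBlowdown

open Set Function Filter Topology
open Literature.Analysis Literature.Analysis.FluidPDE
open Summit.NavierStokesRegularity.NavierStokesRegularity.Theorems

/-! ## §5 Composition and bridges (kernel-checked) -/

/-- **COMPOSITION**: the three obligations decide the cell. -/
theorem row_A13isqT_of_stubs (h1 : SyndeticReturn) (h2 : SyndeticReturn → BlowdownEnhancement)
    (h3 : VanishingBlowdownLiouville) : Row_A13isqT :=
  fun C u _ _ hu hθ hh hS => h3 C u hu (hasVanishingBlowdown_of_screw h1 h2 hu hθ hh hS)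

/-- BRIDGE BY NAME: LADDER-NS K-a (L′) `SymmetryModuliCount.TypeIAncientLiouville` ⇒ the row (strict sub-cell;
the converse must FAIL — probe). -/
theorem row_A13isqT_of_typeIAncientLiouville
    (hL : Summit.NavierStokesRegularity.NavierStokesRegularity.Theses.SymmetryModuliCount.TypeIAncientLiouville) :
    Row_A13isqT :=
  fun C u _ _ hu _ _ _ => hL C u (isTypeIAncientMild_iff.1 hu)

/-- BRIDGE BY NAME: (L′) ⇒ the research residual S3 (S3 is weaker than the wall; the converse must FAIL). -/
theorem vanishingBlowdownLiouville_of_typeIAncientLiouville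
    (hL : Summit.NavierStokesRegularity.NavierStokesRegularity.Theses.SymmetryModuliCount.TypeIAncientLiouville) :
    VanishingBlowdownLiouville :=
  fun C u hu _ => hL C u (isTypeIAncientMild_iff.1 hu)

/-! ### v1.3 — the physical-variables reading of vanishing blow-down (additive; statements of record unchanged)

`hasVanishingBlowdown_of_screw'` says the similarity-variable orbit of an irrational-screw Type-I ancient mild field
tends to `0` locally uniformly as `τ → −∞`.  In physical variables, and using the screw to move every point into a
fundamental slab `0 ≤ x₃ ≤ |h|`, this is FAR-PAST SMALLNESS ON PARABOLIC CYLINDERS around the axis, uniformly in `x₃`: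
`∀ ε A > 0, ∃ T < 0, ∀ t < T, ∀ x, x₀² + x₁² ≤ A²(−t) → √(−t)‖u(t,x)‖ ≤ ε` (PROVED below, sorry-free; it uses only
S1/S2, not S3).  Nothing of record is proved by it; it is the quotable shape of the partial result. -/

/-- Linearity of the rotation across an axial translate. -/
theorem rotZ_add_smul_eZ (θ : ℝ) (a : E3) (c : ℝ) : rotZ θ (a + c • eZ) = rotZ θ a + c • eZ := by
  ext i; fin_cases i <;> simp [rotZ, eZ]

/-- The inverse screw: a `(θ, h)`-equivariant field is `(−θ, −h)`-equivariant. -/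
theorem isScrewEquivariant_inv {θ h : ℝ} {u : ℝ → E3 → E3} (hu : IsScrewEquivariant θ h u) :
    IsScrewEquivariant (-θ) (-h) u := by
  intro t ht x
  have key := hu t ht (rotZ (-θ) x + (-h) • eZ)
  have e1 : rotZ θ (rotZ (-θ) x + (-h) • eZ) + h • eZ = x := by
    rw [rotZ_add_smul_eZ, ← rotZ_add, add_neg_cancel, rotZ_zero, add_assoc, ← add_smul, neg_add_cancel,
      zero_smul, add_zero]
  rw [e1] at key
  rw [key, ← rotZ_add, neg_add_cancel, rotZ_zero]

/-- Integer powers of the screw. -/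
theorem isScrewEquivariant_zmul {θ h : ℝ} {u : ℝ → E3 → E3} (hu : IsScrewEquivariant θ h u) (n : ℤ) :
    IsScrewEquivariant ((n : ℝ) * θ) ((n : ℝ) * h) u := by
  obtain ⟨k, rfl | rfl⟩ := Int.eq_nat_or_neg n
  · have := isScrewEquivariant_iterate hu k
    simpa using this
  · have := isScrewEquivariant_iterate (isScrewEquivariant_inv hu) k
    have e1 : (((-(k : ℤ)) : ℤ) : ℝ) * θ = (k : ℝ) * -θ := by push_cast; ring
    have e2 : (((-(k : ℤ)) : ℤ) : ℝ) * h = (k : ℝ) * -h := by push_cast; ring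
    rw [e1, e2]
    exact this

/-- Fundamental slab, positive drift: every point has a screw image with the same distance to the axis, the same
`‖u‖`, and height in `[0, h]`. -/
theorem exists_slab_point_pos {θ h : ℝ} {u : ℝ → E3 → E3} (hS : IsScrewEquivariant θ h u) (hh : 0 < h)
    {t : ℝ} (ht : t < 0) (x : E3) :
    ∃ x' : E3, x' 0 ^ 2 + x' 1 ^ 2 = x 0 ^ 2 + x 1 ^ 2 ∧ 0 ≤ x' 2 ∧ x' 2 ≤ h ∧ ‖u t x'‖ = ‖u t x‖ := by
  obtain ⟨n, hn⟩ : ∃ n : ℤ, n = -⌊x 2 / h⌋ := ⟨_, rfl⟩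
  refine ⟨rotZ ((n : ℝ) * θ) x + ((n : ℝ) * h) • eZ, ?_, ?_, ?_, ?_⟩
  · have hsc := Real.sin_sq_add_cos_sq ((n : ℝ) * θ)
    simp [eZ]
    linear_combination (x 0 ^ 2 + x 1 ^ 2) * hsc
  · have h1 : ((⌊x 2 / h⌋ : ℤ) : ℝ) ≤ x 2 / h := Int.floor_le _
    have h2 : ((⌊x 2 / h⌋ : ℤ) : ℝ) * h ≤ x 2 := by rwa [le_div_iff₀ hh] at h1
    simp [eZ, hn]
    linarith
  · have h1 : x 2 / h < ((⌊x 2 / h⌋ : ℤ) : ℝ) + 1 := Int.lt_floor_add_one _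
    have h2 : x 2 < (((⌊x 2 / h⌋ : ℤ) : ℝ) + 1) * h := by rwa [div_lt_iff₀ hh] at h1
    simp [eZ, hn]
    linarith
  · rw [isScrewEquivariant_zmul hS n t ht x, norm_rotZ]

/-- Fundamental slab for any non-zero drift (height in `[0, |h|]`). -/
theorem exists_slab_point {θ h : ℝ} {u : ℝ → E3 → E3} (hS : IsScrewEquivariant θ h u) (hh : h ≠ 0)
    {t : ℝ} (ht : t < 0) (x : E3) :
    ∃ x' : E3, x' 0 ^ 2 + x' 1 ^ 2 = x 0 ^ 2 + x 1 ^ 2 ∧ 0 ≤ x' 2 ∧ x' 2 ≤ |h| ∧ ‖u t x'‖ = ‖u t x‖ := by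
  rcases lt_or_gt_of_ne hh with hneg | hpos
  · obtain ⟨x', h1, h2, h3, h4⟩ := exists_slab_point_pos (isScrewEquivariant_inv hS) (neg_pos.2 hneg) ht x
    exact ⟨x', h1, h2, by rwa [abs_of_neg hneg], h4⟩
  · obtain ⟨x', h1, h2, h3, h4⟩ := exists_slab_point_pos hS hpos ht x
    exact ⟨x', h1, h2, by rwa [abs_of_pos hpos], h4⟩

/-- Norm bound for a point of the rescaled slab: `y₀² + y₁² ≤ A²`, `0 ≤ y₂ ≤ B` ⇒ `‖y‖ ≤ √(A² + B²)`. -/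
theorem norm_le_of_slab {A B : ℝ} {y : E3} (h1 : y 0 ^ 2 + y 1 ^ 2 ≤ A ^ 2) (h2 : 0 ≤ y 2) (h3 : y 2 ≤ B) :
    ‖y‖ ≤ Real.sqrt (A ^ 2 + B ^ 2) := by
  rw [EuclideanSpace.norm_eq]
  apply Real.sqrt_le_sqrt
  simp only [Fin.sum_univ_three, Real.norm_eq_abs, sq_abs]
  nlinarith [mul_le_mul h3 h3 h2 (h2.trans h3)]

/-- **Far-past smallness on parabolic cylinders (v1.3, PROVED).**  For a Type-I ancient mild field equivariant under
ONE screw of irrational turn with drift `h ≠ 0`: for every `ε, A > 0` there is `T < 0` such that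
`√(−t) ‖u(t,x)‖ ≤ ε` whenever `t < T` and `x₀² + x₁² ≤ A²(−t)` — uniformly in the axial coordinate.  Proof:
otherwise points `(t_k, x_k)`, `t_k → −∞`, violate it; move `x_k` into the slab by the screw, zoom out by
`μ_k = √(−t_k)`, extract a blow-down limit `W` (tree extraction) — it vanishes by `hasVanishingBlowdown_of_screw'`
— while the rescaled points converge in the compact slab and carry `‖·‖ > ε`: contradiction with locally uniform
convergence.  Uses S1/S2 only.  Nothing of record is proved. -/
theorem farPast_parabolicCylinder_smallness_of_screw {C : ℝ} {u : ℝ → E3 → E3} {θ₀ h : ℝ}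
    (hu : IsTypeIAncientMild C u) (hθ : Irrational (θ₀ / (2 * Real.pi))) (hh : h ≠ 0)
    (hS : IsScrewEquivariant θ₀ h u) :
    ∀ ε > (0 : ℝ), ∀ A > (0 : ℝ), ∃ T < (0 : ℝ), ∀ t < T, ∀ x : E3,
      x 0 ^ 2 + x 1 ^ 2 ≤ A ^ 2 * (-t) → Real.sqrt (-t) * ‖u t x‖ ≤ ε := by
  by_contra H
  push Not at H
  obtain ⟨ε, hε, A, hA, H⟩ := H
  have H' : ∀ k : ℕ, ∃ t, t < -((k : ℝ) + 1) ∧ ∃ x : E3,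
      x 0 ^ 2 + x 1 ^ 2 ≤ A ^ 2 * (-t) ∧ ε < Real.sqrt (-t) * ‖u t x‖ :=
    fun k => H _ (by linarith [(Nat.cast_nonneg k : (0 : ℝ) ≤ k)])
  choose t ht x hx hbig using H'
  have htneg : ∀ k, t k < 0 := fun k => by linarith [ht k, (Nat.cast_nonneg k : (0 : ℝ) ≤ k)]
  -- move each point into the fundamental slab
  have Hs : ∀ k, ∃ x' : E3, x' 0 ^ 2 + x' 1 ^ 2 = x k 0 ^ 2 + x k 1 ^ 2 ∧ 0 ≤ x' 2 ∧ x' 2 ≤ |h| ∧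
      ‖u (t k) x'‖ = ‖u (t k) (x k)‖ := fun k => exists_slab_point hS hh (htneg k) (x k)
  choose x' hx'1 hx'2 hx'3 hx'4 using Hs
  -- the scales
  obtain ⟨μ, hμdef⟩ : ∃ μ : ℕ → ℝ, ∀ k, μ k = Real.sqrt (-t k) := ⟨_, fun k => rfl⟩
  have hμpos : ∀ k, 0 < μ k := fun k => by rw [hμdef]; exact Real.sqrt_pos.2 (by linarith [htneg k])
  have hμsq : ∀ k, μ k ^ 2 = -t k := fun k => by rw [hμdef]; exact Real.sq_sqrt (by linarith [htneg k])
  have hμone : ∀ k, 1 ≤ μ k := fun k => by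
    rw [hμdef, ← Real.sqrt_one]
    exact Real.sqrt_le_sqrt (by linarith [ht k, (Nat.cast_nonneg k : (0 : ℝ) ≤ k)])
  have hμlim : Tendsto μ atTop atTop := by
    have h1 : Tendsto (fun k : ℕ => Real.sqrt ((k : ℝ) + 1)) atTop atTop :=
      Real.tendsto_sqrt_atTop.comp (tendsto_atTop_add_const_right _ _ tendsto_natCast_atTop_atTop)
    refine tendsto_atTop_mono (fun k => ?_) h1
    rw [hμdef]
    exact Real.sqrt_le_sqrt (by linarith [ht k])
  -- the rescaled points live in a fixed compact slab
  obtain ⟨y, hydef⟩ : ∃ y : ℕ → E3, ∀ k, y k = (μ k)⁻¹ • x' k := ⟨_, fun k => rfl⟩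
  have hy0 : ∀ k, y k 0 ^ 2 + y k 1 ^ 2 ≤ A ^ 2 := by
    intro k
    have e : y k 0 ^ 2 + y k 1 ^ 2 = (μ k)⁻¹ ^ 2 * (x' k 0 ^ 2 + x' k 1 ^ 2) := by
      simp only [hydef, PiLp.smul_apply, smul_eq_mul]; ring
    rw [e, hx'1 k]
    have hμ0 : μ k ≠ 0 := (hμpos k).ne'
    calc (μ k)⁻¹ ^ 2 * (x k 0 ^ 2 + x k 1 ^ 2) ≤ (μ k)⁻¹ ^ 2 * (A ^ 2 * (-t k)) :=
          mul_le_mul_of_nonneg_left (hx k) (by positivity)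
      _ = A ^ 2 := by rw [← hμsq k, inv_pow]; field_simp
  have hy2 : ∀ k, 0 ≤ y k 2 := fun k => by
    simp only [hydef, PiLp.smul_apply, smul_eq_mul]
    exact mul_nonneg (inv_nonneg.2 (hμpos k).le) (hx'2 k)
  have hy3 : ∀ k, y k 2 ≤ |h| := fun k => by
    simp only [hydef, PiLp.smul_apply, smul_eq_mul]
    calc (μ k)⁻¹ * x' k 2 ≤ 1 * x' k 2 :=
          mul_le_mul_of_nonneg_right (inv_le_one_of_one_le₀ (hμone k)) (hx'2 k)
      _ ≤ |h| := by rw [one_mul]; exact hx'3 k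
  have hmem : ∀ k, y k ∈ Metric.closedBall (0 : E3) (Real.sqrt (A ^ 2 + |h| ^ 2)) := fun k => by
    rw [Metric.mem_closedBall, dist_zero_right]
    exact norm_le_of_slab (hy0 k) (hy2 k) (hy3 k)
  -- the zooms evaluated at the rescaled points are large
  have hval : ∀ k, nsRescale (μ k) u (-1) (y k) = μ k • u (t k) (x' k) := by
    intro k
    simp only [nsRescale, hydef, smul_smul, mul_inv_cancel₀ (hμpos k).ne', one_smul]
    congr 2
    rw [hμsq k]; ring
  have hlarge : ∀ k, ε < ‖nsRescale (μ k) u (-1) (y k)‖ := by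
    intro k
    rw [hval k, norm_smul, Real.norm_eq_abs, abs_of_pos (hμpos k), hx'4 k, hμdef k]
    exact hbig k
  -- extraction of a blow-down limit: it vanishes
  obtain ⟨φ, hφ, W, hW, -, -, hloc, -⟩ :=
    exists_tendsto_of_isTypeIAncientMild_seq C (w := fun k => nsRescale (μ k) u)
      fun k => isTypeIAncientMild_nsRescale hu (hμpos k)
  have hBD : IsBlowdownLimit C u W :=
    ⟨hW, fun k => μ (φ k), fun k => hμpos _, hμlim.comp hφ.tendsto_atTop, fun t ht => hloc t ht⟩
  have hW0 : ∀ t < (0 : ℝ), ∀ x, W t x = 0 := hasVanishingBlowdown_of_screw' hu hθ hh hS W hBD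
  -- a convergent sub-subsequence of the rescaled points
  obtain ⟨ys, -, ψ, hψ, hys⟩ :=
    tendsto_subseq_of_bounded (Metric.isBounded_closedBall) (fun i => hmem (φ i))
  have hsub : TendstoLocallyUniformly (fun i => nsRescale (μ (φ (ψ i))) u (-1)) (W (-1)) atTop :=
    tendstoLocallyUniformly_subseq (hloc (-1) (by norm_num)) hψ
  have hcontW : Continuous (W (-1)) := hW.continuous_slice (by norm_num)
  have hys' : Tendsto (fun i => y (φ (ψ i))) atTop (𝓝 ys) := hys
  have hL : Tendsto (fun i => nsRescale (μ (φ (ψ i))) u (-1) (y (φ (ψ i)))) atTop (𝓝 (W (-1) ys)) :=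
    hsub.tendsto_comp hcontW.continuousAt hys'
  rw [hW0 (-1) (by norm_num) ys] at hL
  have hnorm : Tendsto (fun i => ‖nsRescale (μ (φ (ψ i))) u (-1) (y (φ (ψ i)))‖) atTop (𝓝 0) := by
    have h0 := hL.norm
    rwa [norm_zero] at h0
  obtain ⟨i, hi⟩ := (hnorm.eventually (gt_mem_nhds hε)).exists
  exact absurd (hlarge (φ (ψ i))) (not_lt.2 hi.le)

/-- The same smallness on parabolic BALLS `‖x‖ ≤ A√(−t)` (a weaker, symmetric-looking reading). -/
theorem farPast_parabolicBall_smallness_of_screw {C : ℝ} {u : ℝ → E3 → E3} {θ₀ h : ℝ}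
    (hu : IsTypeIAncientMild C u) (hθ : Irrational (θ₀ / (2 * Real.pi))) (hh : h ≠ 0)
    (hS : IsScrewEquivariant θ₀ h u) :
    ∀ ε > (0 : ℝ), ∀ A > (0 : ℝ), ∃ T < (0 : ℝ), ∀ t < T, ∀ x : E3,
      ‖x‖ ≤ A * Real.sqrt (-t) → Real.sqrt (-t) * ‖u t x‖ ≤ ε := by
  intro ε hε A hA
  obtain ⟨T, hT, hT'⟩ := farPast_parabolicCylinder_smallness_of_screw hu hθ hh hS ε hε A hA
  refine ⟨T, hT, fun t ht x hx => hT' t ht x ?_⟩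
  have hx0 : 0 ≤ A * Real.sqrt (-t) := by positivity
  have h1 : x 0 ^ 2 + x 1 ^ 2 ≤ ‖x‖ ^ 2 := by
    rw [EuclideanSpace.norm_eq, Real.sq_sqrt (Finset.sum_nonneg fun i _ => by positivity)]
    simp only [Fin.sum_univ_three, Real.norm_eq_abs, sq_abs]
    nlinarith [sq_nonneg (x 2)]
  have h2 : ‖x‖ ^ 2 ≤ (A * Real.sqrt (-t)) ^ 2 := pow_le_pow_left₀ (norm_nonneg _) hx 2
  have h3 : (A * Real.sqrt (-t)) ^ 2 = A ^ 2 * (-t) := by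
    rw [mul_pow, Real.sq_sqrt (by linarith)]
  linarith [h1, h2, h3.le, h3.ge]

end Summit.NavierStokesRegularity.NavierStokesRegularity.Theorems.ScenarioCensus.ScrewBlowdown
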